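import Mathlib
import Summits.Ventures.PercRepro2.AS3Corr

/-!
# STEP(0,3) is Reimer's inequality when the red side cannot carry two disjoint members
(seat mine-b, cell pub-perc-repro2; conjectures/MINE-B.md §16.5)

`Φ = R + c` (AS3Corr.lean) with `c = #{A □ B at γ ∧ ρ ∈ B} − #{B □ B at γ ∧ ρ ∈ A}`.  For the STEP row
`A ⟹ B □ B` (e.g. `A = B □ B`, or `A = pinFlow 2` on a pattern), the second count needs FOUR pairwise
disjoint `B`-members inside the cube (two blue, two red).  So when the cube carries no four pairwise
disjoint members — `¬ (B □ B) □ (B □ B)` on the cube, i.e. packing number `≤ 3` — the second count is `0`,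
`c ≥ 0`, and (AS3) is Reimer's inequality for increasing events (`AS3_of_no_four`).

Graph reading (`stepH_zero_three_of_no_four`): **STEP(0,3)** `#{F_R = 0 ∧ F_B ≥ 3} ≤ #{F_R = 1 ∧ F_B ≥ 2}`
holds on every pattern `(O, Y)` in which `O ∪ Y` has no four `s–t` paths pairwise disjoint on `Y`
(`O`-edges may be shared) — in particular on every unpinned pattern of a graph with `λ(s,t) ≤ 3` (the
λ = 3 strands of the B2 line), where STEP(0,3) was so far known only as a consequence of the (AS3)
conjecture.  With `N(i,k) = #{lev_B ρ = i ∧ lev_B γ = k}` the correction of the row is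
`c = N(1, ≥3) − N(≥2, 2)`; the theorem is the case where both vanish.
-/

open Finset

namespace Summit.Ventures.PercRepro2

namespace StepZero

open ReimerCube

variable {V : Type*} {E : Type*} [DecidableEq E]

open Classical

omit [DecidableEq E] in
/-- disjoint occurrence is increasing in the configuration -/
lemma dOcc_mono_config {A B : Finset E → Prop} {S T : Finset E} (hST : S ⊆ T) (h : DOcc A B S) :
    DOcc A B T := by
  obtain ⟨K, L, hK, hL, hKL, hA, hB⟩ := h
  exact ⟨K, L, hK.trans hST, hL.trans hST, hKL, hA, hB⟩

/-- If `A` forces two disjoint `B`-members and the cube `U` carries no four pairwise disjoint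
`B`-members, then no configuration has `B □ B` on the blue side and `A` on the red side. -/
theorem cM_eq_zero_of_no_four (U : Finset E) {A B : Finset E → Prop} (hAB : ∀ X, A X → DOcc B B X)
    (hν : ¬ DOcc (DOcc B B) (DOcc B B) U) : cM U A B = 0 := by
  unfold cM
  rw [Finset.card_eq_zero, Finset.filter_eq_empty_iff]
  intro γ hγ
  rw [Finset.mem_powerset] at hγ
  rintro ⟨hBB, hAρ⟩
  apply hν
  refine ⟨γ, U \ γ, hγ, Finset.sdiff_subset, Finset.disjoint_sdiff, ?_, ?_⟩
  · intro T hT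
    exact dOcc_mono_config hT hBB
  · intro T hT
    exact dOcc_mono_config hT (hAB _ hAρ)

/-- **(AS3) under packing number `≤ 3`**: for increasing `A`, `B` with `A ⟹ B □ B`, if the cube carries
no four pairwise disjoint `B`-members then (AS3) holds — it is Reimer's inequality. -/
theorem AS3_of_no_four (U : Finset E) {A B : Finset E → Prop} (hA : Incr A) (hB : Incr B)
    (hAB : ∀ X, A X → DOcc B B X) (hν : ¬ DOcc (DOcc B B) (DOcc B B) U) : AS3 U A B := by
  apply AS3_of_corr_nonneg U hA hB
  unfold corr
  rw [cM_eq_zero_of_no_four U hAB hν]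
  push_cast
  omega

/-- the STEP row `(B □ B, B)` itself: STEP(0,3) of every clutter of packing number `≤ 3` on the cube -/
theorem AS3_root_of_no_four (U : Finset E) {B : Finset E → Prop} (hB : Incr B)
    (hν : ¬ DOcc (DOcc B B) (DOcc B B) U) : AS3 U (DOcc B B) B :=
  AS3_of_no_four U (fun _ _ hST h => dOcc_mono_config hST h) hB (fun _ h => h) hν

/-- two edge-disjoint `s–t` paths in `O ∪ X` give two `Y`-disjoint pinned connections -/
lemma dOcc_pinCarries_of_pinFlow_two (ends : E → Sym2 V) (s t : V) (O : Finset E) {X : Finset E}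
    (h : pinFlow ends s t O 2 X) : DOcc (pinCarries ends s t O) (pinCarries ends s t O) X := by
  have h' := dOcc_of_pinFlow_succ ends s t O 1 h
  exact h'.mono_left (fun T hT => (pinFlow_one_iff ends s t O T).mp hT)

/-- **STEP(0,3) on every pattern without four pairwise `Y`-disjoint `s–t` paths**
(`O`-edges may be shared by the paths): `#{F_R = 0 ∧ F_B ≥ 3} ≤ #{F_R = 1 ∧ F_B ≥ 2}`. -/
theorem stepH_zero_three_of_no_four (ends : E → Sym2 V) (s t : V) (O Y : Finset E)
    (hν : ¬ DOcc (DOcc (pinCarries ends s t O) (pinCarries ends s t O))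
      (DOcc (pinCarries ends s t O) (pinCarries ends s t O)) Y) :
    stepH ends s t O Y 0 3 ≤ stepH ends s t O Y 1 2 := by
  apply stepH_zero_of_AS3 ends s t O Y 2
  exact AS3_of_no_four Y (incr_pinFlow ends s t O 2) (incr_pinCarries ends s t O)
    (fun _ h => dOcc_pinCarries_of_pinFlow_two ends s t O h) hν

end StepZero

end Summit.Ventures.PercRepro2
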